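import Literature.AlgebraicGeometry.Resolution.Lipman1969RationalSurfaceSingularities
import Literature.AlgebraicGeometry.Resolution.PrimeDivisorIdeals
import Literature.AlgebraicGeometry.Resolution.Blowups
import Mathlib.AlgebraicGeometry.IdealSheaf.Subscheme
import Mathlib.RingTheory.Length
import HarnessLib

/-!
# Rational contraction of exceptional curves of the first kind and the numerical criterion (M) for
# the minimal desingularization, over a rational surface singularity, in `h⁰`-lengths
# (Lipman 1969, Theorem (27.1), Corollaries (27.2)–(27.3), with Prop. (1.2), Thm. (4.1), Prop. (13.1))

Topic: `Literature/AlgebraicGeometry/Resolution`. NAMED FACTS (D-0014), typed from the printed pages of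
J. Lipman, *Rational singularities, with applications to algebraic surfaces and unique
factorization*, Publ. Math. IHÉS 36 (1969) 195–279 (doi:10.1007/BF02684604; held copy
`paper:doi-10-1007-bf02684604`, read on the page: PDF pp. 81–85 = printed pp. 274–278 (§27), PDF
p. 6 = p. 199 (Def. (1.1), Prop. (1.2)), PDF p. 11 = p. 204 (Thm. (4.1)), PDF pp. 19–22 = pp. 212–215
(§10), PDF pp. 27–31 = pp. 220–224 (Thm. (12.1), §13)), continuing
`Resolution/Lipman1969RationalSurfaceSingularities` (`HasRationalSingularity`, `Lipman1969_1_2`,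
`Lipman1969_4_1`, `IsMinimalResolution`, `excCurvePoints`) in the vocabulary that file and this
directory already use (`IsResolution`, `IsBlowup` of `Resolution/Blowups`, `primeDivisorIdeal` of
`Resolution/PrimeDivisorIdeals`, Mathlib `Scheme.IdealSheafData` with its powers and its closed
subscheme `IdealSheafData.subscheme`, `Module.length`).

## The source (quoted from the printed paper; two displays of (27.1) and the display (M) of (27.3)
## are OCR-damaged in the held scan and are restored from the surrounding proof text, as marked)

§27 (p. 274 bottom – p. 275): "Let `A` be a noetherian ring and let `f : X → Spec(A)` be a map of
finite type. As in §13, a curve on `X` will be an effective divisor with one-dimensional support. Let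
`E₁, E₂, …, Eₙ` be distinct integral curves on `X` with exceptional support (cf. §12) such that `X` is
normal at every point `x ∈ ⋃E_i`. We say that `⋃E_i` *contracts to a point* (over the ground ring
`A`) if there is a (separated) scheme `Y` of finite type over `A` and a proper `Spec(A)`-morphism
`h : X → Y` such that `h(⋃E_i)` is a single normal point `P` and such that `h` induces an isomorphism
of `X − ⋃E_i` onto `Y − P`. (Remarks. Such an `h` is easily seen to be birational … Moreover, the
local ring `S` of `P` on `Y` is necessarily two-dimensional … `Y` and `h` are unique (up to
isomorphism).) We say that `⋃E_i` is *rationally contractible* if there exists `h` as above with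
`R¹h_*(𝒪_X) = 0`. … there exists among the curves `C = Σ r_i E_i` such that `(C·E_i) ≤ 0` for all
`i` a unique smallest one, which is called the *fundamental curve* for `⋃E_i`."

**Theorem (27.1)** (p. 275). "Let `A` be a noetherian ring and let `f : X → Spec(A)` be a projective
map. Let `E₁, E₂, …, Eₙ` be distinct integral curves on `X` with exceptional support (relative to `f`)
such that `X` is normal at every point of `⋃E_i`; assume further that `⋃E_i` is connected and that the
intersection matrix `((E_i·E_j))` is negative-definite. Let `C` be the fundamental curve for `⋃E_i`.
Then there exists `h : X → Y` contracting `⋃E_i` rationally over `A` to a point `P` if and only if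
`χ(C) > 0`. When this condition holds, `Y` is projective over `A`, the multiplicity of `P` on `Y` is
`−(C²)/h⁰(C)`, and `Y` is regular at `P` if and only if `(C²) = −h⁰(C)`." [The two displays read
"—(C^/A^G)" and "(G^—A^C)" in the scan; they are restored from the proof, p. 276: "Since `H¹(𝒪_C)`
vanishes (`𝒪_C` being a homomorphic image of `𝒪_X`), and since `H⁰(𝒪_C) = S/m` …, we have
`χ(C) = h⁰(C) = 1 > 0`. … This shows that `S` has multiplicity `−(C²) = −(C²)/h⁰(C)`, and that `S`
is regular … if and only if `(C²) = −1 = −h⁰(C)`" — after the reduction of p. 275: "if we replace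
`X` by `X'` and `A` by `S`, the effect is merely to divide all the integers involved in the theorem by
the residual degree of `P` over `Q`".]

**Corollary (27.2)** (p. 277). "Let `Y` be a normal surface having only finitely many singular points,
all of which are rational singularities. If `Y` is proper over a noetherian ring `A`, then `Y` is
projective over `A`."

**Corollary (27.3)** (p. 277). "(Cf. [6]; Lemma (1.6).) Let `Y` be a surface which admits a
desingularization `g : Z → Y`. Then `Y` has a unique minimal desingularization `f : X → Y` (i.e. every
desingularization of `Y` factors through `f`). `Z = X` if and only if (M): `(E²) + χ(E) < 0` for every
exceptional integral curve `E` on `Z`. (Remark. The terminology of (M) needs a word of explanation: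
`E` is 'exceptional' if `g(E)` is a single point `Q` of `Y`, and then `(E²)` and `χ(E)` are calculated
over some affine neighbourhood `Spec(A)` of `Q`.)" [The display (M) reads "(E^—s^E)" in the scan; it
is restored from the proof, p. 277 bottom – p. 278: "if `Z = X`, then (27.1) and (27.2) show that no
integral exceptional curve `E` on `Z` satisfies simultaneously `χ(E) > 0` (i.e. `h¹(E) = 0`) and
`(E²) = −h⁰(E)`; thus either `χ(E) ≤ 0`, in which case (M) holds because `(E²) < 0`, or
`χ(E) = h⁰(E) > 0` and `(E²) ≤ −2h⁰(E) = −2χ(E)`", together with p. 278: "`(F·F) + χ(F) = 0`" for the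
curve of a quadratic transformation and "repeated application … shows that `(E²) + χ(E) ≥ 0`,
contradicting (M)".]

Used in the dictionary below (all proved in the paper): **Definition (1.1)** and **Proposition (1.2)
2)** (p. 199): "A normal local ring `R` of dimension 2 is said to have a rational singularity if there
exists a desingularization `f : X → Spec(R)` such that `H¹(X, 𝒪_X) = 0`. … 2) If `W` is normal and `g`
is proper then `H¹(W, 𝒪_W) = 0`" (for `g : W → Spec(R)` birational of finite type); **Theorem (4.1)**
(p. 204): "… any desingularization of `Y` is a product of quadratic transformations" (for a normal
surface `Y` with finitely many singular points, all rational); the remark in the proof of (12.1)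
(p. 220): "Since the fibres of `f` have dimension `≤ 1`, `H²(ℱ) = 0` for all coherent `𝒪_X`-modules
`ℱ` [EGA III, (4.2.2)]"; §10 (p. 212): `h⁰`, `h¹` = the lengths over `A` of `H⁰`, `H¹`, and
`χ = h⁰ − h¹`, for coherent sheaves on a curve proper over `Spec A` with zero-dimensional image; §13
(p. 223): "'`h^i(E)`', '`χ(E)`' in place of '`h^i(𝒪_E)`', '`χ(𝒪_E)`'", `𝒪_E = 𝒪_X/𝒪(−E)`; and
**Proposition (13.1) d)** (p. 223): "`χ(E) + χ(F) − χ(E + F) = (E·F)`" for curves `E`, `F` on `X`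
with exceptional support (`E + F` the curve with ideal `𝒪(−E)𝒪(−F)`), whence `(E·E) = 2χ(E) − χ(2E)`.

## What is vendored, and in which vocabulary (a TRANSLATION into `h⁰`-lengths, flagged as such)

The facts are typed over a two-dimensional normal Noetherian local domain `S` with a RATIONAL
singularity (`HasRationalSingularity S`), for a desingularization `π : X → Spec S` (`IsResolution`:
proper, birational, `X` regular). There every number in (27.1)/(27.3) is an `h⁰`-LENGTH over `S`, by
the following dictionary (each step is one of the quoted results), for `E = E_η = cl{η}` an integral
exceptional curve (`η ∈ excCurvePoints π`: over the closed point, one-dimensional closure) with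
ideal sheaf `𝓘 = primeDivisorIdeal η` (the vanishing ideal of `cl{η}`, i.e. `E` with its reduced
structure; invertible because `X` is regular, so `E` and `2E := V(𝓘²)` are "curves on `X`" in the sense
of §13, with exceptional support):
* `H¹(X, 𝒪_X) = 0` (Prop. (1.2) 2), `X` being normal and `π` proper birational), and `H² = 0` on `X`
  (fibres of dimension `≤ 1`), so `H¹` of every quotient `𝒪_X/𝒥` vanishes: `h¹(E) = h¹(2E) = 0`,
  `χ(E) = h⁰(E) = h0 π 𝓘`, `χ(2E) = h⁰(2E) = h0 π (𝓘²)` (`h0`, below, IS Lipman's `h⁰`: the length over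
  the base of the global sections);
* Prop. (13.1) d): `(E·E) = 2χ(E) − χ(2E) = 2·h0 π 𝓘 − h0 π (𝓘²)`;
* hence `E` is OF THE FIRST KIND — `χ(E) > 0` and `(E·E) = −h⁰(E)`, the curves which (27.1) contracts
  to a REGULAR point — iff **`h0 π (𝓘²) = 3·h0 π 𝓘`**, and `E` satisfies (M) — `(E·E) + χ(E) < 0` —
  iff **`3·h0 π 𝓘 < h0 π (𝓘²)`** (checks: the exceptional line of one point blow-up, `(E²) = −h⁰(E)`:
  `h⁰(2E) = 3h⁰(E)`, first kind, violates (M); a `(−2)`-curve with `h⁰(E) = 1`: `h⁰(2E) = 4 > 3`,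
  satisfies (M));
* for a contraction `h : X → Y` of such an `E` to a point `P`, the residual degree of `P` over the
  closed point of `S` is `h⁰(E)`: `H⁰(𝒪_E) = κ(P)` (proof of (27.1), p. 276, with p. 275).
WITHOUT `HasRationalSingularity S` these `h⁰`-renderings are NOT Lipman's statements (then `χ` needs
`h¹`); the hypothesis is mandatory in both facts.

* `h0 π 𝓘` — **`h⁰(𝒪_X/𝓘) := length_S Γ(X, 𝒪_X/𝓘)`**: the length over `S` of the ring of global sections
  of the closed subscheme `V(𝓘)` (`IdealSheafData.subscheme`, `subschemeι`) of the `S`-scheme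
  `π : X → Spec S`, an `S`-module through `S → Γ(X, 𝒪_X) → Γ(V(𝓘), 𝒪)` (`Morphisms.Sections`); in `ℕ∞`
  (finite when `V(𝓘)` is proper over `S` with support in the closed fibre, §10 p. 212 / EGA III 3.2.1;
  `⊤` otherwise — never the case under the hypotheses of the facts).
* `Lipman1969_27_3_rat` — Corollary (27.3), criterion (M), for `Y = Spec S` (`S` as above; a surface
  admitting a desingularization) and a desingularization `π : X → Spec S`: `π` IS the minimal
  desingularization (`IsMinimalResolution π`: every desingularization of `Spec S` factors through `π`
  — Lipman's "`Z = X`" for the unique minimal `X`, two desingularizations dominating each other being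
  isomorphic) iff every integral exceptional curve `E_η`, `η ∈ excCurvePoints π` (over the local base,
  every integral curve of `X` mapped to a point is mapped to the closed point, so these are all of
  Lipman's "exceptional integral curves"), satisfies `3·h0 π 𝓘_η < h0 π (𝓘_η²)`.
* `Lipman1969_27_1_reg_rat` — Theorem (27.1) at `n = 1`, `C = E` a first-kind integral exceptional
  curve, applied to each member of a finite family of pairwise DISJOINT such curves `E_η`, `η ∈ F`, on a
  desingularization `π : X → Spec S` (`X` is projective over `S` by Corollary (27.2), a regular surface
  proper over `S`; `⋃E_i = E_η` is connected, `((E_η·E_η)) = (−h⁰(E_η))` is negative-definite, and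
  `χ(E_η) = h⁰(E_η) > 0`): the curves contract, one after the other (a curve disjoint from the
  contracted one is carried isomorphically, with its numbers, to the contracted surface, which is again
  a projective desingularization of `Spec S`), to REGULAR points, so that altogether there are a
  desingularization `g : Y → Spec S` and an `S`-morphism `h : X → Y` (`h ≫ g = π`) with
  `h⁻¹(h(η)) = E_η` for `η ∈ F`, the points `h(η)` closed, `h` an isomorphism of `X − ⋃E_η` onto
  `Y − {h(η)}`, residual degrees `[κ(h(η)) : κ] = h⁰(E_η)` (as `h0 g` of the reduced point), and `h` the
  blowing-up of `Y` along the reduced finite set `{h(η) : η ∈ F}` (`IsBlowup`; Theorem (4.1): the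
  desingularization `h` of the regular surface `Y` is a product of quadratic transformations, and a
  product with exactly the `|F|` irreducible exceptional curves `E_η` over the `|F|` distinct points
  `h(η)` is the blow-up of those points). For `F = ∅` the conclusion holds with `h = 𝟙` (the blow-up of
  the unit ideal). Users take `(h : Lipman1969_27_3_rat)` / `(h : Lipman1969_27_1_reg_rat)`.

VACUITY: neither `Prop` is decided by unfolding; the hypothesis blocks are satisfiable (e.g. `S` a
regular local ring of dimension `2`, `π` the blow-up of the closed point: one exceptional curve, of the
first kind, so (27.3) says `π` is not minimal — indeed `𝟙_{Spec S}` is — and (27.1) contracts it back).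

## What is NOT here

The proofs; (27.1) for `n ≥ 2` curves with connected union (fundamental curve, intersection matrix),
over a non-local or non-rational base, for `X` merely normal along `⋃E_i`, its "only if" half, the
rationality `R¹h_* 𝒪_X = 0` and the projectivity of the contraction, and the multiplicity
`−(C²)/h⁰(C)`; Corollary (27.2) as a statement (used above only inside the justification); (27.3) for a
general surface `Y` and for non-rational singularities, where `χ(E) = h⁰(E) − h¹(E)` needs `H¹` (the
honest `χ`-form `(E²) + χ(E) < 0` with `(E²) := 2χ(𝓘_E) − χ(𝓘_E²)` is the shape to type then); the
exercise of p. 278 (behaviour of `(E·E) + χ(E)` under a quadratic transformation).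
`-- TODO(general form)` lines record these. Consumers: the crux chain W4.4 (`HomologicalConductor`,
`NoZenoR`) of the summit `ResolutionOfSingularities`, typed-proof debts of its `(L1-w)` step; nothing
here depends on that summit. Mathlib searched (pin): `Module.length`, `Scheme.IdealSheafData`
(`vanishingIdeal`, `subscheme`, `subschemeι`, `^`), `morphismRestrict` (all used); Mathlib has no
blow-ups, no intersection numbers and no cohomology of coherent sheaves on schemes.

## References

* J. Lipman, *Rational singularities, with applications to algebraic surfaces and unique
  factorization*, Publ. Math. IHÉS 36 (1969) 195–279: §27, Thm. (27.1) (p. 275, proof pp. 275–277),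
  Cor. (27.2), Cor. (27.3) (p. 277, proof pp. 277–278); Def. (1.1), Prop. (1.2) (p. 199); Thm. (4.1)
  (p. 204); §10 (p. 212); Thm. (12.1) and its proof (p. 220); §13, Prop. (13.1) (pp. 222–224).
  [Lipman1969]
* L. Bădescu, *Algebraic Surfaces*, Universitext (2001), Thm. 3.30–3.32 (Castelnuovo's contractibility
  criterion over an algebraically closed field), Def. 4.4 (minimal desingularization) — context for
  `IsMinimalResolution`. [Badescu2001]
* U. Görtz, T. Wedhorn, *Algebraic Geometry I* (2nd ed., 2020), Def. 13.90 (blow-up, the universal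
  property rendered by `IsBlowup`). [GortzWedhorn2020]
-/

noncomputable section

open CategoryTheory AlgebraicGeometry TopologicalSpace IsLocalRing
open Literature.AlgebraicGeometry.Morphisms

universe u

namespace Literature.AlgebraicGeometry.Resolution

/-! ## §A. The numerical vocabulary: `h⁰`-lengths of closed subschemes over the base -/

section Numerics

variable {S : Type u} [CommRing S] {X : Scheme.{u}}

/-- **`h⁰(𝒪_X/𝓘) := length_S Γ(X, 𝒪_X/𝓘)`** for an `S`-scheme `π : X → Spec S` and an ideal sheaf `𝓘`
on `X`: the length over `S` of the ring of global sections of the closed subscheme `V(𝓘)` (Mathlib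
`IdealSheafData.subscheme`, with its closed immersion `subschemeι` into `X`), an `S`-module through
`S → Γ(Spec S) → Γ(X) → Γ(V(𝓘))` (`Morphisms.Sections` of `subschemeι ≫ π`), valued in `ℕ∞`. This is
Lipman's `h⁰(𝒪_C)`, `C = V(𝓘)` — "the length of `H⁰`" over the base ring (§10, p. 212: "the
cohomology modules of any coherent `𝒪_C`-module `ℱ` are of finite length over `A`; it makes sense
therefore to talk about `h⁰(ℱ)` and `h¹(ℱ)` (the lengths of `H⁰(ℱ)`, `H¹(ℱ)` respectively)"; §13,
p. 223: "'`h^i(E)`' in place of '`h^i(𝒪_E)`'") — whenever `V(𝓘)` is a curve proper over `S` with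
zero-dimensional image (then finite); `⊤` when the length is infinite. For `𝓘 = 𝓘_E = primeDivisorIdeal η`
on a desingularization of a two-dimensional normal local `S` with a rational singularity, `h0 π 𝓘_E =
h⁰(E) = χ(E)` and `h0 π (𝓘_E ^ 2) = h⁰(𝒪_{2E}) = χ(2E)`, so that `(E·E) = 2·h0 π 𝓘_E − h0 π (𝓘_E²)`
(module docstring). [cite: Lipman1969, Section 10 (p. 212) and Section 13 (p. 223), "h⁰"] -/
def h0 (π : X ⟶ Spec (.of S)) (𝓘 : X.IdealSheafData) : ℕ∞ :=
  Module.length S (Sections (𝓘.subschemeι ≫ π) ⊤)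

/-- Unfolding of `h0` (`rfl`). [cite: Lipman1969, Section 10 (p. 212), "h⁰"] -/
theorem h0_eq (π : X ⟶ Spec (.of S)) (𝓘 : X.IdealSheafData) :
    h0 π 𝓘 = Module.length S (Sections (𝓘.subschemeι ≫ π) ⊤) :=
  rfl

end Numerics

/-! ## §B. The named facts -/

/-- NAMED FACT — **Lipman 1969, Corollary (27.3) with criterion (M), over a rational surface
singularity, in `h⁰`-lengths**: "Let `Y` be a surface which admits a desingularization `g : Z → Y`.
Then `Y` has a unique minimal desingularization `f : X → Y` (i.e. every desingularization of `Y`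
factors through `f`). `Z = X` if and only if (M): `(E²) + χ(E) < 0` for every exceptional integral
curve `E` on `Z`." Rendered for `Y = Spec S`, `S` a two-dimensional normal Noetherian local domain
with a RATIONAL singularity (`HasRationalSingularity S`, Definition (1.1); in particular `Y` is a
surface admitting a desingularization), and a desingularization `π : X → Spec S` (`IsResolution`:
proper, birational, `X` regular): `π` is the minimal desingularization (`IsMinimalResolution π`: every
desingularization of `Spec S` factors through `π` — Lipman's "`Z = X`") iff every integral exceptional
curve `E_η`, `η ∈ excCurvePoints π` (points over the closed point with one-dimensional closure — all of
Lipman's "exceptional integral curves" over the local base), satisfies (M) in the `h⁰`-form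
`3·h⁰(𝒪_{E_η}) < h⁰(𝒪_{2E_η})`, i.e. `3 * h0 π 𝓘_η < h0 π (𝓘_η ^ 2)` with `𝓘_η = primeDivisorIdeal η` —
which IS `(E²) + χ(E) < 0` by the dictionary of the module docstring (Prop. (1.2) 2): `H¹(X, 𝒪_X) = 0`;
`H² = 0` on fibres of dimension `≤ 1`; Prop. (13.1) d): `(E·E) = 2χ(E) − χ(2E)`), valid BECAUSE `S` is
rational; without `HasRationalSingularity S` this rendering would not be Lipman's statement. Both
implications are the printed "if and only if" (proof pp. 277–278). Users take
`(h : Lipman1969_27_3_rat)`. [cite: Lipman1969, Corollary (27.3) (p. 277; proof pp. 277–278)] -/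
def Lipman1969_27_3_rat : Prop :=
  ∀ (S : Type u) [CommRing S] [IsNoetherianRing S] [IsLocalRing S] [IsDomain S]
    [IsIntegrallyClosed S], ringKrullDim S = 2 → HasRationalSingularity S →
    ∀ (X : Scheme.{u}) (π : X ⟶ Spec (.of S)), IsResolution π →
      (IsMinimalResolution π ↔
        ∀ η ∈ excCurvePoints π, 3 * h0 π (primeDivisorIdeal η) < h0 π (primeDivisorIdeal η ^ 2))
-- TODO(general form): Lipman states (27.3) for every surface `Y` admitting a desingularization
-- (not only `Spec` of a local ring with a rational singularity), with (M) in the form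
-- `(E²) + χ(E) < 0`, `χ(E) = h⁰(E) − h¹(E)` computed over an affine neighbourhood of `g(E)`; its
-- first clause (existence and uniqueness of the minimal desingularization) is `Lipman1969_4_1` for
-- rational singularities.

/-- NAMED FACT — **Lipman 1969, Theorem (27.1) (rational contraction of exceptional curves of the
first kind to regular points), over a rational surface singularity, in `h⁰`-lengths, for a finite
disjoint family**: "Let `A` be a noetherian ring and let `f : X → Spec(A)` be a projective map. Let
`E₁, …, Eₙ` be distinct integral curves on `X` with exceptional support (relative to `f`) such that `X`
is normal at every point of `⋃E_i`; assume further that `⋃E_i` is connected and that the intersection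
matrix `((E_i·E_j))` is negative-definite. Let `C` be the fundamental curve for `⋃E_i`. Then there
exists `h : X → Y` contracting `⋃E_i` rationally over `A` to a point `P` if and only if `χ(C) > 0`. When
this condition holds, `Y` is projective over `A`, the multiplicity of `P` on `Y` is `−(C²)/h⁰(C)`, and
`Y` is regular at `P` if and only if `(C²) = −h⁰(C)`." Rendered at `n = 1`, `C = E_η = cl{η}` an
integral exceptional curve OF THE FIRST KIND — `h0 π (𝓘_η ^ 2) = 3 * h0 π 𝓘_η`, i.e. `χ(E) = h⁰(E) > 0`
and `(E²) = −h⁰(E)` by the dictionary of the module docstring — on a desingularization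
`π : X → Spec S` of a two-dimensional normal Noetherian local domain `S` with a RATIONAL singularity
(`X` regular, hence normal along `E` and `E` Cartier; `X` projective over `S` by Corollary (27.2);
`((E²)) = (−h⁰(E))` negative-definite; `E` connected), and ITERATED along a finite set `F` of such `η`
whose curves `cl{η}` are pairwise disjoint (each contraction is an isomorphism near the remaining
curves, which keep their `h⁰`-numbers on the contracted surface, again a projective desingularization
of `Spec S`): there are a desingularization `g : Y → Spec S` (`IsResolution g`; the contracted surface
is regular at the new points by (27.1) and isomorphic to `X` elsewhere) and an `S`-morphism `h : X → Y`
(`h ≫ g = π`) such that, for `η ∈ F`, the point `h(η)` is closed and `h⁻¹(h(η)) = cl{η}` ("contracts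
`E_η` to the point `h(η)`"), `h` restricts to an isomorphism of `X − ⋃_{η ∈ F} cl{η}` onto
`Y − h(F)`, the residual degree of `h(η)` over the closed point of `S` — `h⁰` of the reduced point,
`h0 g (vanishingIdeal {h(η)})` — equals `h⁰(E_η) = h0 π 𝓘_η` (proof of (27.1), p. 276: `H⁰(𝒪_C) = S/𝔪`
after base change to the local ring of `P`, with p. 275: "divide all the integers … by the residual
degree of `P`"), and `h` is the blowing-up of `Y` along the reduced finite set `h(F)` (`IsBlowup`;
Theorem (4.1): the desingularization `h` of the regular surface `Y` is a product of quadratic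
transformations, and one with exactly the `|F|` irreducible exceptional curves `cl{η}` over the `|F|`
distinct points `h(η)` is the blow-up of these points). For `F = ∅`: `Y = X`, `h = 𝟙` (a blow-up of
the unit ideal). Users take `(h : Lipman1969_27_1_reg_rat)`.
[cite: Lipman1969, Theorem (27.1) (p. 275; proof pp. 275–277), with Corollary (27.2) (p. 277) and Theorem (4.1) (p. 204)] -/
def Lipman1969_27_1_reg_rat : Prop :=
  ∀ (S : Type u) [CommRing S] [IsNoetherianRing S] [IsLocalRing S] [IsDomain S]
    [IsIntegrallyClosed S], ringKrullDim S = 2 → HasRationalSingularity S →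
    ∀ (X : Scheme.{u}) (π : X ⟶ Spec (.of S)), IsResolution π →
    ∀ (F : Set X), F.Finite → F ⊆ excCurvePoints π →
      (∀ η ∈ F, ∀ η' ∈ F, η ≠ η' → Disjoint (closure {η}) (closure ({η'} : Set X))) →
      (∀ η ∈ F, h0 π (primeDivisorIdeal η ^ 2) = 3 * h0 π (primeDivisorIdeal η)) →
      ∃ (Y : Scheme.{u}) (g : Y ⟶ Spec (.of S)) (h : X ⟶ Y)
        (hc : ∀ η ∈ F, IsClosed ({h.base η} : Set Y)) (hC : IsClosed (h.base '' F)),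
        h ≫ g = π ∧ IsResolution g ∧
        -- `h` contracts `E_η = cl{η}` to the point `h(η)` and nothing else, for `η ∈ F`
        (∀ η ∈ F, h.base ⁻¹' {h.base η} = closure {η}) ∧
        -- `h` is an isomorphism of `X − ⋃ E_η` onto `Y − h(F)`
        IsIso (h ∣_ (⟨(h.base '' F)ᶜ, hC.isOpen_compl⟩ : Y.Opens)) ∧
        -- the residual degree of `h(η)` over the closed point of `S` is `h⁰(E_η)`
        (∀ (η : X) (hη : η ∈ F),
          h0 g (Scheme.IdealSheafData.vanishingIdeal ⟨{h.base η}, hc η hη⟩) =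
            h0 π (primeDivisorIdeal η)) ∧
        -- `h` is the blowing-up of `Y` along the reduced finite set of the contracted points
        IsBlowup h (Scheme.IdealSheafData.vanishingIdeal ⟨h.base '' F, hC⟩)
-- TODO(general form): Lipman proves (27.1) for `n ≥ 1` curves with connected union and
-- negative-definite intersection matrix over any noetherian `A` and projective `f`, `X` normal
-- along `⋃E_i`, with the fundamental curve `C`: rational contractibility iff `χ(C) > 0`, `Y`
-- projective over `A`, multiplicity `−(C²)/h⁰(C)`, regularity iff `(C²) = −h⁰(C)`; the contraction
-- is rational (`R¹h_*𝒪_X = 0`) and unique. Corollary (27.2) (properness ⇒ projectivity for normal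
-- surfaces with finitely many rational singularities) is not typed as a statement.

end Literature.AlgebraicGeometry.Resolution

end
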